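import Summits.Schanuel.Schanuel.Theorems.DiophantineDichotomyKhovanskiiApproxTypeTransferOfSiegelLemmas

/-!
# `stub_transferOfSiegel` — Siegel inside the ideal of the challenger ⇒ the codimension-one transfer

Route `DiophantineDichotomy`, crux `KhovanskiiApproxType` (stmt-Schanuel-6116), line `lw-small-height`,
registered stub `stub_transferOfSiegel : SiegelInIdeal → CodimOneTransfer` (all objects from
`Summits.Schanuel.Schanuel.Theorems.DiophantineDichotomyDefs`; the slot heights and the box-polynomial /
mean value lemmas are the registered sub-goal `stub_transferOfSiegel_lemmas`, file
`DiophantineDichotomyKhovanskiiApproxTypeTransferOfSiegelLemmas.lean`, namespace `TransferOfSiegel`).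

The argument: given a decoupled codimension-one measure `(μ, K, C)` at `ω ∈ ℂᵐ` and an algebraic
challenger `γ` (`[ℚ(γ):ℚ] ≤ d`, slots of degree `≥ d'`, integer relations of degree `≤ d` and height
`≤ H`), the Siegel lemma inside the ideal of `γ` (hypothesis `SiegelInIdeal`, shape `(A, B, E)`) with the
least `t` such that `A(d+1) ≤ (t+1)^m` (`t ≤ (2A)^{1/m} d^{1/m}`, `exists_degree_param`) gives a
non-zero `Q ∈ ℤ[X₁,…,X_m]` on the box `[0,t]^m` with `Q(γ) = 0` and
`log H(Q) ≤ log⁺B + E t + E t Σⱼ h(γⱼ)`, where `Σⱼ h(γⱼ) ≤ m (log H + d)/d'`; the codimension-one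
measure at `Q` bounds `|Q(ω)|` from below, the mean value estimate
`|Q(ω)| = |Q(ω) − Q(γ)| ≤ N·H(Q)·mt·R^{mt}·‖ω − γ‖` (`R = ‖ω‖ + 2`, WLOG `‖γ − ω‖ ≤ 1`) from above,
and the exponent bookkeeping `exists_transferConst` (pure real analysis, explicit constant) gives
`‖γ − ω‖ ≥ exp(−C'(d^{(μ+1)/m}(log H + d)/d' + d^{(max μ K+1)/m+1}))`.
-/

noncomputable section

-- `Summit.Schanuel.Schanuel.…` is the mandated summit/sub-problem namespace (single-conjunct summit), hence:
set_option linter.dupNamespace false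

namespace Summit.Schanuel.Schanuel.Cruxes.KhovanskiiApproxType.LwSmallHeight

open Literature.NumberTheory.Transcendental (weilHeight₁ weilHeight₁_nonneg)
open Polynomial

namespace TransferOfSiegel

/-! ## The degree parameter and the exponent bookkeeping -/

/-- THE DEGREE PARAMETER: the least `t` with `A(d+1) ≤ (t+1)^m` satisfies `t ≤ (2A)^{1/m} d^{1/m}`. -/
theorem exists_degree_param (A : ℝ) (hA : 0 < A) (m : ℕ) (hm : 1 ≤ m) (d : ℕ) (hd : 1 ≤ d) :
    ∃ t : ℕ, A * ((d : ℝ) + 1) ≤ ((t : ℝ) + 1) ^ m ∧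
      (t : ℝ) ≤ (2 * A) ^ (1 / m : ℝ) * (d : ℝ) ^ (1 / m : ℝ) := by
  classical
  have hex : ∃ t : ℕ, A * ((d : ℝ) + 1) ≤ ((t : ℝ) + 1) ^ m := by
    refine ⟨⌈A * ((d : ℝ) + 1)⌉₊, ?_⟩
    have h1 : A * ((d : ℝ) + 1) ≤ ⌈A * ((d : ℝ) + 1)⌉₊ := Nat.le_ceil _
    have h0 : (0 : ℝ) ≤ ⌈A * ((d : ℝ) + 1)⌉₊ := Nat.cast_nonneg _
    calc A * ((d : ℝ) + 1) ≤ (⌈A * ((d : ℝ) + 1)⌉₊ : ℝ) + 1 := by linarith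
      _ ≤ _ := le_self_pow₀ (by linarith) (by omega)
  refine ⟨Nat.find hex, Nat.find_spec hex, ?_⟩
  set t := Nat.find hex with ht
  rcases Nat.eq_zero_or_pos t with h0 | hpos
  · rw [h0, Nat.cast_zero]; positivity
  · have hmin : ¬ (A * ((d : ℝ) + 1) ≤ (((t - 1 : ℕ) : ℝ) + 1) ^ m) := Nat.find_min hex (by omega)
    have hcast : (((t - 1 : ℕ) : ℝ) + 1) = t := by
      rw [Nat.cast_sub hpos]; push_cast; ring
    rw [hcast, not_le] at hmin
    have h1d : (1 : ℝ) ≤ d := by exact_mod_cast hd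
    have h2d : A * ((d : ℝ) + 1) ≤ 2 * A * d := by nlinarith
    have hm0 : m ≠ 0 := by omega
    have ht0 : (0 : ℝ) ≤ t := Nat.cast_nonneg _
    calc (t : ℝ) = ((t : ℝ) ^ m) ^ (1 / m : ℝ) := by rw [one_div, Real.pow_rpow_inv_natCast ht0 hm0]
      _ ≤ (2 * A * d) ^ (1 / m : ℝ) := Real.rpow_le_rpow (by positivity) (by linarith) (by positivity)
      _ = (2 * A) ^ (1 / m : ℝ) * (d : ℝ) ^ (1 / m : ℝ) := Real.mul_rpow (by positivity) (by positivity)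

/-- EXPONENT BOOKKEEPING (pure real analysis).  There is a constant `C' > 0` (depending on `m, μ, K, C`,
the Siegel shape `E`, `LB = log⁺ B`, `LR = log(‖ω‖ + 2)` and `c₁ = (2A)^{1/m}`; explicitly, with
`c₂ = m (c₁ + 1)`, `C' = C c₂^μ (LB + E c₁ + E c₁ m) + C c₂^K + LB + 2 m c₁ + E c₁ + E c₁ m + m c₁ LR + 1`)
such that, with `δ = d^{1/m}`, whenever `t ≤ c₁ δ`, `1 ≤ Δ ≤ m(t+1)`, `0 ≤ log H₁ ≤ LB + E t + E t S` and
`0 ≤ S ≤ m (L + d)/d'` (`d, d' ≥ 1`, `L ≥ 0`), the total loss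
`C(Δ^μ log H₁ + Δ^K) + LB + 2mt + Et + EtS + mt·LR` is at most
`C' · (d^{(μ+1)/m} (L + d)/d' + d^{(max μ K + 1)/m + 1})`. -/
theorem exists_transferConst {m : ℕ} (hm : 1 ≤ m) {μ K C E LB LR c₁ : ℝ} (hμ : 0 ≤ μ)
    (hK : 0 ≤ K) (hC : 0 ≤ C) (hE : 0 ≤ E) (hLB : 0 ≤ LB) (hLR : 0 ≤ LR) (hc₁ : 0 ≤ c₁) :
    ∃ C' : ℝ, 0 < C' ∧ ∀ {d d' L t Δ LH S : ℝ}, 1 ≤ d → 1 ≤ d' → 0 ≤ L →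
      t ≤ c₁ * d ^ (1 / m : ℝ) → 1 ≤ Δ → Δ ≤ m * (t + 1) → 0 ≤ LH →
      LH ≤ LB + E * t + E * t * S → 0 ≤ S → S ≤ m * ((L + d) / d') →
      C * (Δ ^ μ * LH + Δ ^ K) + LB + (2 * m * t + E * t + E * t * S + m * t * LR) ≤
        C' * (d ^ ((μ + 1) / m) * (L + d) / d' + d ^ ((max μ K + 1) / m + 1)) := by
  set c₂ : ℝ := (m : ℝ) * (c₁ + 1) with hc₂
  have hm1 : (1 : ℝ) ≤ m := by exact_mod_cast hm
  have hm0 : (0 : ℝ) < m := by linarith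
  have hc₂0 : 0 ≤ c₂ := by positivity
  have hc₂μ : 0 ≤ c₂ ^ μ := Real.rpow_nonneg hc₂0 _
  have hc₂K : 0 ≤ c₂ ^ K := Real.rpow_nonneg hc₂0 _
  refine ⟨C * c₂ ^ μ * (LB + E * c₁ + E * c₁ * m) + C * c₂ ^ K + LB + 2 * m * c₁ + E * c₁ +
    E * c₁ * m + m * c₁ * LR + 1, by positivity, ?_⟩
  intro d d' L t Δ LH S hd hd' hL htc hΔ1 hΔ hLH0 hLH hS0 hS
  set δ := d ^ (1 / m : ℝ) with hδ
  set q : ℝ := (max μ K + 1) / m + 1 with hq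
  set p : ℝ := (μ + 1) / m with hp
  have hd0 : 0 < d := by linarith
  have hd'0 : 0 < d' := by linarith
  have hδ1 : 1 ≤ δ := Real.one_le_rpow hd (by positivity)
  have hδ0 : 0 ≤ δ := by linarith
  -- the two summands of the target
  set Y : ℝ := d ^ p * (L + d) / d' with hY
  set Z : ℝ := d ^ q with hZ
  have hmax0 : 0 ≤ max μ K := le_trans hμ (le_max_left _ _)
  have hq0 : 0 ≤ q := by positivity
  have hZ1 : 1 ≤ Z := Real.one_le_rpow hd hq0
  have hLd : 0 ≤ L + d := by linarith
  have hY0 : 0 ≤ Y := by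
    have : 0 ≤ d ^ p := Real.rpow_nonneg hd0.le _
    positivity
  -- exponent comparisons: `d^s ≤ Z` for `s ≤ q`
  have hexp : ∀ s : ℝ, s ≤ q → d ^ s ≤ Z := fun s hs => Real.rpow_le_rpow_of_exponent_le hd hs
  have hq1 : (max μ K + 1) / m ≤ q := by rw [hq]; linarith
  have h1m : 1 / (m : ℝ) ≤ q :=
    le_trans (div_le_div_of_nonneg_right (by linarith) hm0.le) hq1
  have hμm : μ / m ≤ q :=
    le_trans (div_le_div_of_nonneg_right (by linarith [le_max_left μ K]) hm0.le) hq1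
  have hKm : K / m ≤ q :=
    le_trans (div_le_div_of_nonneg_right (by linarith [le_max_right μ K]) hm0.le) hq1
  have hpq : p ≤ q :=
    le_trans (div_le_div_of_nonneg_right (by linarith [le_max_left μ K]) hm0.le) hq1
  have hδμ : δ ^ μ = d ^ (μ / m) := by
    rw [hδ, ← Real.rpow_mul hd0.le]; congr 1; ring
  have hδK : δ ^ K = d ^ (K / m) := by
    rw [hδ, ← Real.rpow_mul hd0.le]; congr 1; ring
  have hδp : δ ^ μ * δ = d ^ p := by
    rw [hδμ, hδ, ← Real.rpow_add hd0, hp, add_div]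
  have hδZ : δ ≤ Z := hexp _ h1m
  have hμZ : δ ^ μ ≤ Z := by rw [hδμ]; exact hexp _ hμm
  have hKZ : δ ^ K ≤ Z := by rw [hδK]; exact hexp _ hKm
  have hpZ : δ ^ μ * δ ≤ Z := by rw [hδp]; exact hexp _ hpq
  have hδμ1 : 1 ≤ δ ^ μ := Real.one_le_rpow hδ1 hμ
  have hδμ0 : 0 ≤ δ ^ μ := by linarith
  -- `Δ ≤ c₂ δ`, `Δ^μ ≤ c₂^μ δ^μ`, `Δ^K ≤ c₂^K δ^K`
  have hΔc : Δ ≤ c₂ * δ := by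
    calc Δ ≤ m * (t + 1) := hΔ
      _ ≤ m * (c₁ * δ + δ) := by gcongr
      _ = c₂ * δ := by rw [hc₂]; ring
  have hΔ0 : 0 ≤ Δ := by linarith
  have hΔμ : Δ ^ μ ≤ c₂ ^ μ * δ ^ μ := by
    rw [← Real.mul_rpow hc₂0 hδ0]; exact Real.rpow_le_rpow hΔ0 hΔc hμ
  have hΔK : Δ ^ K ≤ c₂ ^ K * δ ^ K := by
    rw [← Real.mul_rpow hc₂0 hδ0]; exact Real.rpow_le_rpow hΔ0 hΔc hK
  -- `t ≤ c₁ Z`, `t S ≤ c₁ m Y`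
  have htZ : t ≤ c₁ * Z := htc.trans (by gcongr)
  have htS : t * S ≤ c₁ * m * Y := by
    calc t * S ≤ (c₁ * δ) * (m * ((L + d) / d')) := mul_le_mul htc hS hS0 (by positivity)
      _ = c₁ * m * (δ * ((L + d) / d')) := by ring
      _ ≤ c₁ * m * ((δ ^ μ * δ) * ((L + d) / d')) := by
          gcongr
          exact le_mul_of_one_le_left hδ0 hδμ1
      _ = c₁ * m * Y := by rw [hδp, hY, mul_div_assoc]
  -- the height term: `Δ^μ · LH ≤ c₂^μ (LB·Z + E c₁·Z + E c₁ m·Y)`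
  have k2 : Δ ^ μ * LH ≤ c₂ ^ μ * (LB * Z + E * c₁ * Z + E * c₁ * m * Y) := by
    have h1 : E * t ≤ E * (c₁ * δ) := mul_le_mul_of_nonneg_left htc hE
    have h2 : E * t * S ≤ E * (c₁ * δ) * S := mul_le_mul_of_nonneg_right h1 hS0
    have hLH'' : LH ≤ LB + E * (c₁ * δ) + E * (c₁ * δ) * S := by linarith only [hLH, h1, h2]
    have step : Δ ^ μ * LH ≤ (c₂ ^ μ * δ ^ μ) * (LB + E * (c₁ * δ) + E * (c₁ * δ) * S) :=
      mul_le_mul hΔμ hLH'' hLH0 (by positivity)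
    have e1 : LB * δ ^ μ ≤ LB * Z := mul_le_mul_of_nonneg_left hμZ hLB
    have e3 : δ ^ μ * δ * S ≤ m * Y := by
      calc δ ^ μ * δ * S ≤ (δ ^ μ * δ) * (m * ((L + d) / d')) :=
            mul_le_mul_of_nonneg_left hS (by positivity)
        _ = m * Y := by rw [hδp, hY]; ring
    have f2 : E * c₁ * (δ ^ μ * δ) ≤ E * c₁ * Z := mul_le_mul_of_nonneg_left hpZ (by positivity)
    have f3 : E * c₁ * (δ ^ μ * δ * S) ≤ E * c₁ * (m * Y) :=
      mul_le_mul_of_nonneg_left e3 (by positivity)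
    have expand : (c₂ ^ μ * δ ^ μ) * (LB + E * (c₁ * δ) + E * (c₁ * δ) * S) =
        c₂ ^ μ * (LB * δ ^ μ + E * c₁ * (δ ^ μ * δ) + E * c₁ * (δ ^ μ * δ * S)) := by ring
    rw [expand] at step
    have inner : LB * δ ^ μ + E * c₁ * (δ ^ μ * δ) + E * c₁ * (δ ^ μ * δ * S) ≤
        LB * Z + E * c₁ * Z + E * c₁ * m * Y := by linarith only [e1, f2, f3]
    exact step.trans (mul_le_mul_of_nonneg_left inner hc₂μ)
  have k3 : Δ ^ K ≤ c₂ ^ K * Z := hΔK.trans (mul_le_mul_of_nonneg_left hKZ hc₂K)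
  have k4 : C * (Δ ^ μ * LH) ≤ C * (c₂ ^ μ * (LB * Z + E * c₁ * Z + E * c₁ * m * Y)) :=
    mul_le_mul_of_nonneg_left k2 hC
  have k5 : C * Δ ^ K ≤ C * (c₂ ^ K * Z) := mul_le_mul_of_nonneg_left k3 hC
  have k6 : m * t * LR ≤ m * (c₁ * Z) * LR :=
    mul_le_mul_of_nonneg_right (mul_le_mul_of_nonneg_left htZ hm0.le) hLR
  have k7 : E * t ≤ E * (c₁ * Z) := mul_le_mul_of_nonneg_left htZ hE
  have k8 : E * (t * S) ≤ E * (c₁ * m * Y) := mul_le_mul_of_nonneg_left htS hE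
  have k9 : (m : ℝ) * t ≤ m * (c₁ * Z) := mul_le_mul_of_nonneg_left htZ hm0.le
  have k10 : LB ≤ LB * Z := le_mul_of_one_le_right hLB hZ1
  -- assemble (everything is linear in the monomials once the products below are signed)
  have n1 : 0 ≤ C * c₂ ^ μ * LB * Y := by positivity
  have n2 : 0 ≤ C * c₂ ^ μ * E * c₁ * Y := by positivity
  have n3 : 0 ≤ C * c₂ ^ μ * E * c₁ * m * Z := by positivity
  have n4 : 0 ≤ C * c₂ ^ K * Y := by positivity
  have n5 : 0 ≤ LB * Y := by positivity
  have n6 : 0 ≤ m * c₁ * Y := by positivity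
  have n7 : 0 ≤ E * c₁ * Y := by positivity
  have n8 : 0 ≤ E * c₁ * m * Z := by positivity
  have n9 : 0 ≤ m * c₁ * LR * Y := by positivity
  linarith only [k4, k5, k6, k7, k8, k9, k10, n1, n2, n3, n4, n5, n6, n7, n8, n9, hY0, hZ1]

end TransferOfSiegel

/-! ## The transfer -/

open TransferOfSiegel in
/-- `stub_transferOfSiegel` (registered stub of line `lw-small-height`, crux stmt-Schanuel-6116):
SIEGEL INSIDE THE IDEAL OF THE CHALLENGER implies the CODIMENSION-ONE TRANSFER — a decoupled
codimension-one measure with exponents `(μ, K)` at `ω ∈ ℂᵐ` gives the primitive approximation measure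
with exponents `p = (μ+1)/m`, `q = (max μ K + 1)/m + 1` at `ω`. -/
theorem stub_transferOfSiegel : SiegelInIdeal → CodimOneTransfer := by
  intro hS m ω μ K C hm hμ hK hCM
  obtain ⟨hCpos, hC⟩ := hCM
  obtain ⟨A, B, E, hA, hB, hE, hShape⟩ := hS m hm
  -- the constants
  set R : ℝ := ‖ω‖ + 2 with hR
  set B₁ : ℝ := max 1 B with hB₁
  set c₁ : ℝ := (2 * A) ^ (1 / m : ℝ) with hc₁
  have hR1 : 1 ≤ R := by rw [hR]; linarith [norm_nonneg ω]
  have hR0 : 0 < R := by linarith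
  have hB₁1 : 1 ≤ B₁ := le_max_left _ _
  have hB₁0 : 0 < B₁ := by linarith
  have hLB : 0 ≤ Real.log B₁ := Real.log_nonneg hB₁1
  have hLR : 0 ≤ Real.log R := Real.log_nonneg hR1
  have hc₁0 : 0 ≤ c₁ := Real.rpow_nonneg (by positivity) _
  obtain ⟨C', hC'pos, hbook⟩ := exists_transferConst hm hμ hK hCpos.le hE hLB hLR hc₁0
  refine ⟨C', hC'pos, ?_⟩
  intro d d' H γ hd' hD hmin hpoly
  -- basic facts: `1 ≤ d`, `1 ≤ H`
  obtain ⟨P₀, hP₀0, hP₀deg, hP₀H, hP₀γ⟩ := hpoly ⟨0, hm⟩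
  have hd : 1 ≤ d := le_trans (natDegree_pos_of_aeval_root hP₀0 hP₀γ fun x hx => by
      rwa [algebraMap_int_eq, eq_intCast, Int.cast_eq_zero] at hx) hP₀deg
  have hH : 1 ≤ H := one_le_of_coeff_le P₀ hP₀0 H hP₀H
  have hd1 : (1 : ℝ) ≤ d := by exact_mod_cast hd
  have hd'1 : (1 : ℝ) ≤ d' := by exact_mod_cast hd'
  have hH1 : (1 : ℝ) ≤ H := by exact_mod_cast hH
  have hL0 : 0 ≤ Real.log H := Real.log_nonneg hH1
  have hm1 : (1 : ℝ) ≤ m := by exact_mod_cast hm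
  -- WLOG `‖γ - ω‖ ≤ 1`
  by_cases hfar : 1 < ‖γ - ω‖
  · refine le_trans ?_ hfar.le
    rw [Real.exp_le_one_iff, neg_nonpos]
    refine mul_nonneg hC'pos.le (add_nonneg ?_ (Real.rpow_nonneg (by positivity) _))
    exact div_nonneg (mul_nonneg (Real.rpow_nonneg (by positivity) _) (by positivity)) (by positivity)
  have hnear : ‖γ - ω‖ ≤ 1 := not_lt.1 hfar
  -- the field `F = ℚ(γ)` is a number field containing the slots
  set F : IntermediateField ℚ ℂ := IntermediateField.adjoin ℚ (Set.range γ) with hF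
  have halg : ∀ i, IsAlgebraic ℚ (γ i) := fun i => by
    obtain ⟨P, hP0, -, -, hPγ⟩ := hpoly i
    refine ⟨P.map (Int.castRingHom ℚ),
      (Polynomial.map_ne_zero_iff (Int.castRingHom ℚ).injective_int).2 hP0, ?_⟩
    rw [← algebraMap_int_eq, aeval_map_algebraMap]; exact hPγ
  haveI hFfin : FiniteDimensional ℚ F := by
    refine IntermediateField.finiteDimensional_adjoin fun x hx => ?_
    obtain ⟨i, rfl⟩ := hx
    exact (halg i).isIntegral
  have hγF : ∀ j, γ j ∈ F := fun j => IntermediateField.subset_adjoin ℚ _ ⟨j, rfl⟩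
  -- the degree parameter `t` and the auxiliary polynomial `Q`
  obtain ⟨t, ht, htc⟩ := exists_degree_param A hA m hm d hd
  have htc' : (t : ℝ) ≤ c₁ * (d : ℝ) ^ (1 / m : ℝ) := by rw [hc₁]; exact htc
  have hAt : A * ((Module.finrank ℚ F : ℝ) + 1) ≤ ((t : ℝ) + 1) ^ m := by
    refine le_trans ?_ ht
    have : (Module.finrank ℚ F : ℝ) ≤ d := by exact_mod_cast hD
    gcongr
  obtain ⟨Q, hQ0, hbox, hQγ, hHQ⟩ := hShape F γ hγF t hAt
  -- the heights of the slots
  set S : ℝ := ∑ j, weilHeight₁ F (fun _ : Unit => γ j) with hSdef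
  have hS0 : 0 ≤ S := Finset.sum_nonneg fun j _ => weilHeight₁_nonneg F _
  have hS : S ≤ m * ((Real.log H + d) / d') := by
    have hj : ∀ j, weilHeight₁ F (fun _ : Unit => γ j) ≤ (Real.log H + d) / d' := fun j => by
      obtain ⟨P, hP0, hPdeg, hPH, hPγ⟩ := hpoly j
      exact weilHeight₁_slot_le F (hγF j) d d' H hd' (hmin j) P hP0 hPdeg hPH hPγ
    calc S = ∑ j, weilHeight₁ F (fun _ : Unit => γ j) := rfl
      _ ≤ ∑ _j : Fin m, (Real.log H + d) / d' := Finset.sum_le_sum fun j _ => hj j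
      _ = m * ((Real.log H + d) / d') := by
          rw [Finset.sum_const, Finset.card_univ, Fintype.card_fin, nsmul_eq_mul]
  -- the lower bound: the codimension-one measure at `Q`
  set Δ : ℝ := max 1 (Q.totalDegree : ℝ) with hΔdef
  set LH : ℝ := Real.log (max 1 (mvNatHeight Q : ℝ)) with hLHdef
  have hlow : Real.exp (-(C * (Δ ^ μ * LH + Δ ^ K))) ≤ ‖MvPolynomial.aeval ω Q‖ := hC Q hQ0
  have ht0 : (0 : ℝ) ≤ t := Nat.cast_nonneg _
  have hΔ1 : 1 ≤ Δ := le_max_left _ _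
  have hΔ : Δ ≤ m * (t + 1) := by
    refine max_le ?_ ?_
    · calc (1 : ℝ) ≤ t + 1 := by linarith
        _ ≤ m * (t + 1) := le_mul_of_one_le_left (by linarith) hm1
    · have h' : (Q.totalDegree : ℝ) ≤ (m : ℝ) * t := by
        exact_mod_cast totalDegree_le_of_box Q hbox
      refine h'.trans (mul_le_mul_of_nonneg_left (by linarith) (by linarith))
  -- the naive height of `Q`
  have hexpS : 0 ≤ E * t + E * t * S := by positivity
  have hHQ' : (mvNatHeight Q : ℝ) ≤ B₁ * Real.exp (E * t + E * t * S) := by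
    refine hHQ.trans ?_
    have h1 : ((t : ℝ) + 1) ^ E ≤ Real.exp (E * t) := by
      calc ((t : ℝ) + 1) ^ E ≤ (Real.exp t) ^ E :=
            Real.rpow_le_rpow (by positivity) (by linarith [Real.add_one_le_exp (t : ℝ)]) hE
        _ = Real.exp (E * t) := by rw [← Real.exp_mul, mul_comm]
    have h2 : B ≤ B₁ := le_max_right _ _
    calc B * ((t : ℝ) + 1) ^ E * Real.exp (E * t * S)
        ≤ B₁ * Real.exp (E * t) * Real.exp (E * t * S) := by
          apply mul_le_mul_of_nonneg_right _ (Real.exp_pos _).le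
          exact mul_le_mul h2 h1 (Real.rpow_nonneg (by positivity) _) hB₁0.le
      _ = B₁ * Real.exp (E * t + E * t * S) := by rw [Real.exp_add]; ring
  have hH₁ : max 1 (mvNatHeight Q : ℝ) ≤ B₁ * Real.exp (E * t + E * t * S) := by
    refine max_le ?_ hHQ'
    calc (1 : ℝ) = 1 * 1 := by ring
      _ ≤ B₁ * Real.exp (E * t + E * t * S) :=
          mul_le_mul hB₁1 (Real.one_le_exp hexpS) zero_le_one hB₁0.le
  have hLH0 : 0 ≤ LH := Real.log_nonneg (le_max_left _ _)
  have hLH : LH ≤ Real.log B₁ + E * t + E * t * S := by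
    have := Real.log_le_log (by positivity) hH₁
    rw [Real.log_mul hB₁0.ne' (Real.exp_pos _).ne', Real.log_exp] at this
    linarith
  -- the bookkeeping
  have hbook := hbook hd1 hd'1 hL0 htc' hΔ1 hΔ hLH0 hLH hS0 hS
  refine le_trans (Real.exp_le_exp.2 (neg_le_neg hbook)) ?_
  -- the upper bound: the mean value estimate between `γ` and `ω`
  have hωR : ∀ i, ‖ω i‖ ≤ R := fun i => (norm_le_pi_norm ω i).trans (by rw [hR]; linarith)
  have hγR : ∀ i, ‖γ i‖ ≤ R := fun i => by
    have h1 : ‖γ i - ω i‖ ≤ ‖γ - ω‖ := by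
      have := norm_le_pi_norm (γ - ω) i
      rwa [Pi.sub_apply] at this
    calc ‖γ i‖ = ‖(γ i - ω i) + ω i‖ := by rw [sub_add_cancel]
      _ ≤ ‖γ i - ω i‖ + ‖ω i‖ := norm_add_le _ _
      _ ≤ 1 + ‖ω‖ := add_le_add (h1.trans hnear) (norm_le_pi_norm ω i)
      _ ≤ R := by rw [hR]; linarith
  have hup := norm_aeval_sub_aeval_le Q hbox ω γ R hR1 hωR hγR
  rw [hQγ, sub_zero] at hup
  have hN : (Q.support.card : ℝ) ≤ Real.exp (m * t) := by
    have h1 : (Q.support.card : ℝ) ≤ ((t : ℝ) + 1) ^ m := by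
      exact_mod_cast card_support_le_of_box Q hbox
    refine h1.trans ?_
    calc ((t : ℝ) + 1) ^ m ≤ (Real.exp t) ^ m :=
          pow_le_pow_left₀ (by positivity) (by linarith [Real.add_one_le_exp (t : ℝ)]) m
      _ = Real.exp (m * t) := (Real.exp_nat_mul _ _).symm
  have hmt : ((m * t : ℕ) : ℝ) ≤ Real.exp (m * t) := by
    push_cast; linarith [Real.add_one_le_exp ((m : ℝ) * t)]
  have hRmt : R ^ (m * t) = Real.exp ((m : ℝ) * t * Real.log R) := by
    rw [show (m : ℝ) * t * Real.log R = ((m * t : ℕ) : ℝ) * Real.log R by push_cast; ring,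
      Real.exp_nat_mul, Real.exp_log hR0]
  have hfac : (Q.support.card : ℝ) * ((mvNatHeight Q : ℝ) * (((m * t : ℕ) : ℝ) * R ^ (m * t))) ≤
      B₁ * Real.exp (2 * m * t + E * t + E * t * S + m * t * Real.log R) := by
    calc (Q.support.card : ℝ) * ((mvNatHeight Q : ℝ) * (((m * t : ℕ) : ℝ) * R ^ (m * t)))
        ≤ Real.exp (m * t) * ((B₁ * Real.exp (E * t + E * t * S)) *
            (Real.exp (m * t) * R ^ (m * t))) := by gcongr
      _ = B₁ * Real.exp (2 * m * t + E * t + E * t * S + m * t * Real.log R) := by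
          rw [hRmt]
          have e : (2 : ℝ) * m * t + E * t + E * t * S + m * t * Real.log R =
              m * t + (E * t + E * t * S) + m * t + m * t * Real.log R := by ring
          rw [e]; simp only [Real.exp_add]; ring
  have hup' : ‖MvPolynomial.aeval ω Q‖ ≤
      B₁ * Real.exp (2 * m * t + E * t + E * t * S + m * t * Real.log R) * ‖γ - ω‖ := by
    calc ‖MvPolynomial.aeval ω Q‖ ≤ _ := hup
      _ = (Q.support.card : ℝ) * ((mvNatHeight Q : ℝ) * (((m * t : ℕ) : ℝ) * R ^ (m * t))) *
            ‖ω - γ‖ := by ring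
      _ ≤ B₁ * Real.exp (2 * m * t + E * t + E * t * S + m * t * Real.log R) * ‖ω - γ‖ :=
          mul_le_mul_of_nonneg_right hfac (norm_nonneg _)
      _ = _ := by rw [norm_sub_rev]
  -- conclusion
  have hBU : 0 < B₁ * Real.exp (2 * m * t + E * t + E * t * S + m * t * Real.log R) := by positivity
  refine le_of_mul_le_mul_right ?_ hBU
  calc Real.exp (-(C * (Δ ^ μ * LH + Δ ^ K) + Real.log B₁ +
          (2 * m * t + E * t + E * t * S + m * t * Real.log R))) *
        (B₁ * Real.exp (2 * m * t + E * t + E * t * S + m * t * Real.log R))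
      = Real.exp (-(C * (Δ ^ μ * LH + Δ ^ K))) := by
        rw [show B₁ * Real.exp (2 * m * t + E * t + E * t * S + m * t * Real.log R) =
            Real.exp (Real.log B₁ + (2 * m * t + E * t + E * t * S + m * t * Real.log R)) by
              rw [Real.exp_add (Real.log B₁), Real.exp_log hB₁0], ← Real.exp_add]
        congr 1; ring
    _ ≤ ‖MvPolynomial.aeval ω Q‖ := hlow
    _ ≤ B₁ * Real.exp (2 * m * t + E * t + E * t * S + m * t * Real.log R) * ‖γ - ω‖ := hup'
    _ = ‖γ - ω‖ * (B₁ * Real.exp (2 * m * t + E * t + E * t * S + m * t * Real.log R)) := by ring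

end Summit.Schanuel.Schanuel.Cruxes.KhovanskiiApproxType.LwSmallHeight

end
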